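import Summits.Ventures.PercRepro.S1TriangleQ

/-!
# PercRepro — nullity `7`: at most twelve triangles under (C1)–(C3) (p2, gen 17; LEMMA Q sharpened by one)

LEMMA Q's recursion gives `cq 7 = 13` from `cq 6 = 10`; the value `13` is not attained, and this file proves
`s₃ ≤ 12` at nullity `7` by looking at the extremal configuration the recursion would need.

PROOF. Coloops stripped as usual; suppose `s₃ ≥ 13` on a coloop-free `M` with `m` points. Every point lies on
`≥ 3` triangles (deleting it leaves nullity `6`, where `s₃ ≤ 10`), so `m ≤ s₃`; a point `x` of minimum degree has
`t(x)·m ≤ 3·s₃` and `s₃ ≤ t(x) + 10` with `t(x) ≤ 5` (the degree lemma), which forces `t(x) = 3`, `s₃ = 13` and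
`m ≤ 13`. Then `M' = M ∖ x` has nullity `6` and exactly `10` triangles. Let `K` be the coloops of `M'` and
`N = E' ∖ K`: `M'' = M' ∖ K` is coloop-free of nullity `6` with `10` triangles, so every point of `N` lies on `≥ 3`
of them (nullity `5`: `s₃ ≤ 7`) and `|N| ≤ 10`; the rank facts give `|N| ≥ 10`; hence `|K| = (m − 1) − 10 ≤ 2`.
Every triangle through `x` meets `K`: one inside `{x} ∪ N` would put `x` in `cl(N)` and make every `k ∈ K` a coloop
of `M` (`k ∉ cl_{M'}(E' ∖ k) = cl_M(E ∖ k)`). Two distinct triangles through `x` meet only in `x` (C1), so they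
carry distinct points of `K`: `3 = t(x) ≤ |K| ≤ 2`. ∎

Consequence for the table: `cq 8` becomes `15` (the recursion from `12`), the value the `q = 6` lane needs at
`(35, 8)` (p8, INBOX 8523).

* `delete_eRk_eq_of_sdiff`, `delete_coloops_encard_triangles` — deletions of a set of coloops keep the nullity
  and the triangles;
* `exists_degree_mul_le` — a point of degree `≤ 3·s₃/|E|`;
* **`ncard_triangles_le_twelve_of_nullity_seven`** — `s₃ ≤ 12` at nullity `7` under (C1), (C2), (C3);
* the one-step consequence `ncard_triangles_le_fifteen_of_nullity_eight` (`s₃ ≤ 15` at nullity `8`) and the core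
  forms `core_ncard_triangles_le_twelve_of_nullity_seven`, `core_ncard_triangles_le_fifteen_of_nullity_eight` are in
  S1TriangleSevenA (the file split at the 400-line cap; proof text unchanged).
AUTHOR p2 g17; split by p3 g22 at the 400-line cap (RULING (um)(64)) — this file = l.1–377 of p2's 494-line
S1TriangleSeven.lean (sha256 0ba1fabefeb8c514366e6396660bbe57236e676c068be0d487c99516f0ca4c88), bodies byte-identical, only this docstring changed.
Axioms: standard.
-/

open scoped Matroid

namespace PercRepro

namespace S1

open Set

variable {α : Type}

/-- The rank of a set avoiding `D` is the same in `M ＼ D`. -/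
theorem delete_eRk_eq_of_sdiff (M : Matroid α) (D : Set α) {X : Set α} (hX : X ⊆ M.E \ D) :
    (M ＼ D).eRk X = M.eRk X := by
  rw [_root_.Matroid.delete_eq_restrict, _root_.Matroid.restrict_eRk_eq _ hX]

/-- **Deleting a finite set of coloops keeps the nullity and the triangles.** -/
theorem delete_coloops_encard_triangles (M : Matroid α) [M.Finite] (K : Finset α)
    (hK : ∀ k ∈ K, M.IsColoop k) {d : ℕ} (hd : M.E.encard = M.eRank + d) :
    (M ＼ (K : Set α)).E.encard = (M ＼ (K : Set α)).eRank + d ∧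
    ThmN.triangles (M ＼ (K : Set α)) = ThmN.triangles M := by
  classical
  induction K using Finset.induction_on with
  | empty =>
    simp only [Finset.coe_empty, _root_.Matroid.delete_empty, and_true]
    exact hd
  | insert k K hk ih =>
    have hK' : ∀ k ∈ K, M.IsColoop k := fun k hk => hK k (Finset.mem_insert_of_mem hk)
    obtain ⟨ih1, ih2⟩ := ih hK'
    have hkc : M.IsColoop k := hK k (Finset.mem_insert_self k K)
    have hkc' : (M ＼ (K : Set α)).IsColoop k := by
      rw [_root_.Matroid.delete_isColoop_iff]
      refine ⟨?_, hkc.mem_ground, by simpa using hk⟩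
      intro hmem
      apply (_root_.Matroid.isColoop_iff_notMem_closure_compl hkc.mem_ground).1 hkc
      have hsub : (M.E \ (K : Set α)) \ {k} ⊆ M.E \ {k} := fun y hy => ⟨hy.1.1, hy.2⟩
      exact M.closure_subset_closure hsub hmem
    have heq : M ＼ ((insert k K : Finset α) : Set α) = (M ＼ (K : Set α)) ＼ {k} := by
      rw [Finset.coe_insert, Set.insert_eq, Set.union_comm, ← _root_.Matroid.delete_delete]
    have h1 : (M ＼ ((insert k K : Finset α) : Set α)).E.encard =
        (M ＼ ((insert k K : Finset α) : Set α)).eRank + d := by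
      rw [heq]
      exact encard_delete_eq_of_isColoop _ hkc' ih1
    have h2 : ThmN.triangles (M ＼ ((insert k K : Finset α) : Set α)) = ThmN.triangles M := by
      rw [heq, triangles_delete_eq_of_isColoop _ hkc', ih2]
    exact ⟨h1, h2⟩

/-- **A point of at most average degree**: some `x ∈ E` has `t(x)·|E| ≤ 3·s₃` (`E` nonempty). -/
theorem exists_degree_mul_le (M : Matroid α) [M.Finite] (hE : M.E.Nonempty) :
    ∃ x ∈ M.E, (ThmN.trianglesThrough M x).ncard * M.E.ncard ≤ 3 * (ThmN.triangles M).ncard := by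
  by_contra hno
  have hm : 0 < M.E.ncard := (Set.ncard_pos M.ground_finite).2 hE
  have hall : ∀ x ∈ M.E,
      3 * (ThmN.triangles M).ncard / M.E.ncard + 1 ≤ (ThmN.trianglesThrough M x).ncard := by
    intro x hx
    by_contra h
    have h' : (ThmN.trianglesThrough M x).ncard ≤ 3 * (ThmN.triangles M).ncard / M.E.ncard := by omega
    exact hno ⟨x, hx, (Nat.le_div_iff_mul_le hm).1 h'⟩
  have h1 := mul_ncard_ground_le_three_mul_ncard_triangles M
    (3 * (ThmN.triangles M).ncard / M.E.ncard + 1) hall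
  have h2 : 3 * (ThmN.triangles M).ncard <
      (3 * (ThmN.triangles M).ncard / M.E.ncard + 1) * M.E.ncard :=
    Nat.lt_mul_of_div_lt (Nat.lt_succ_self _) hm
  omega

/-- **Nullity `7`: at most twelve triangles** under (C1), (C2), (C3). -/
theorem ncard_triangles_le_twelve_of_nullity_seven (M : Matroid α) [M.Finite]
    (hC1 : ∀ L ⊆ M.E, M.eRk L = 2 → L.ncard ≤ 3) (hC2 : ∀ P ⊆ M.E, M.eRk P ≤ 3 → P.ncard ≤ 6)
    (hC3 : ∀ X ⊆ M.E, M.eRk X ≤ 4 → X.ncard ≤ 10) (hd : M.E.encard = M.eRank + ((7 : ℕ) : ℕ∞)) :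
    (ThmN.triangles M).ncard ≤ 12 := by
  suffices H : ∀ n : ℕ, ∀ (M : Matroid α) [M.Finite], M.E.ncard = n →
      (∀ L ⊆ M.E, M.eRk L = 2 → L.ncard ≤ 3) → (∀ P ⊆ M.E, M.eRk P ≤ 3 → P.ncard ≤ 6) →
      (∀ X ⊆ M.E, M.eRk X ≤ 4 → X.ncard ≤ 10) →
      M.E.encard = M.eRank + ((7 : ℕ) : ℕ∞) → (ThmN.triangles M).ncard ≤ 12 from
    H _ M rfl hC1 hC2 hC3 hd
  intro n
  induction n using Nat.strong_induction_on with
  | _ n ih =>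
  intro M _ hn hC1 hC2 hC3 hd
  classical
  by_cases hcol : ∃ k ∈ M.E, M.IsColoop k
  · -- strip a coloop
    obtain ⟨k, hkE, hk⟩ := hcol
    have hlt : (M ＼ {k}).E.ncard < n := by
      rw [_root_.Matroid.delete_ground, ← hn]
      exact Set.ncard_sdiff_singleton_lt_of_mem hkE M.ground_finite
    have hC1' : ∀ L ⊆ (M ＼ {k}).E, (M ＼ {k}).eRk L = 2 → L.ncard ≤ 3 := by
      intro L hL hr
      rw [_root_.Matroid.delete_ground] at hL
      rw [delete_singleton_eRk_eq hL] at hr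
      exact hC1 L (hL.trans Set.sdiff_subset) hr
    have hC2' : ∀ P ⊆ (M ＼ {k}).E, (M ＼ {k}).eRk P ≤ 3 → P.ncard ≤ 6 := by
      intro P hP hr
      rw [_root_.Matroid.delete_ground] at hP
      rw [delete_singleton_eRk_eq hP] at hr
      exact hC2 P (hP.trans Set.sdiff_subset) hr
    have hC3' : ∀ X ⊆ (M ＼ {k}).E, (M ＼ {k}).eRk X ≤ 4 → X.ncard ≤ 10 := by
      intro X hX hr
      rw [_root_.Matroid.delete_ground] at hX
      rw [delete_singleton_eRk_eq hX] at hr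
      exact hC3 X (hX.trans Set.sdiff_subset) hr
    have hd' : (M ＼ {k}).E.encard = (M ＼ {k}).eRank + ((7 : ℕ) : ℕ∞) :=
      encard_delete_eq_of_isColoop M hk hd
    have := ih _ hlt (M ＼ {k}) rfl hC1' hC2' hC3' hd'
    rwa [triangles_delete_eq_of_isColoop M hk] at this
  have hcol' : ∀ x ∈ M.E, ¬ M.IsColoop x := fun x hx h => hcol ⟨x, hx, h⟩
  by_contra hgt
  have h13 : 13 ≤ (ThmN.triangles M).ncard := by omega
  have hSfin : (ThmN.triangles M).Finite :=
    M.ground_finite.finite_subsets.subset (fun C hC => hC.1.subset_ground)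
  obtain ⟨C, hC⟩ : (ThmN.triangles M).Nonempty := by
    rw [← Set.ncard_pos hSfin]; omega
  -- the rank facts: `m ≥ 12`
  obtain ⟨r, hr, hnr, hr2⟩ := two_add_le_eRank_of_triangle M hd hC
  have hE2 : r ≠ 2 ∨ M.E.ncard ≤ 3 := by
    by_cases h : r = 2
    · refine Or.inr (hC1 M.E (subset_refl _) ?_)
      rw [← _root_.Matroid.eRank_def, hr, h]; norm_num
    · exact Or.inl h
  have hE3 : r ≠ 3 ∨ M.E.ncard ≤ 6 := by
    by_cases h : r = 3
    · refine Or.inr (hC2 M.E (subset_refl _) ?_)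
      rw [← _root_.Matroid.eRank_def, hr, h]; norm_num
    · exact Or.inl h
  have hE4 : r ≠ 4 ∨ M.E.ncard ≤ 10 := by
    by_cases h : r = 4
    · refine Or.inr (hC3 M.E (subset_refl _) ?_)
      rw [← _root_.Matroid.eRank_def, hr, h]; norm_num
    · exact Or.inl h
  have hm12 : 12 ≤ M.E.ncard := by omega
  -- every point has degree `≥ 3` (nullity `6` below: `s₃ ≤ 10`)
  have hdeg3 : ∀ y ∈ M.E, 3 ≤ (ThmN.trianglesThrough M y).ncard := by
    intro y hy
    obtain ⟨hd', hC1', hC2', hle⟩ :=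
      ncard_triangles_le_add_of_not_isColoop M hC1 hC2 (d := 6) hd hy (hcol' y hy)
    have hC3' : ∀ X ⊆ (M ＼ {y}).E, (M ＼ {y}).eRk X ≤ 4 → X.ncard ≤ 10 := by
      intro X hX hr
      rw [_root_.Matroid.delete_ground] at hX
      rw [delete_singleton_eRk_eq hX] at hr
      exact hC3 X (hX.trans Set.sdiff_subset) hr
    have h10 := ncard_triangles_le_cq (M ＼ {y}) hC1' hC2' hC3' hd'
    rw [show cq 6 = 10 by decide] at h10
    omega
  -- degrees are `≤ 5`
  have hdeg5 : ∀ z, M.IsNonloop z → (ThmN.trianglesThrough M z).ncard ≤ 5 := by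
    intro z hz
    by_contra h
    have h6 : 7 ≤ (ThmN.trianglesThrough M z).ncard + 1 := by omega
    have := ncard_triangles_le_succ_of_degree M hC1 hC2 hd hz h6
    omega
  -- a point of minimum degree: `t(x) = 3`, `s₃ = 13`, `m ≤ 13`
  obtain ⟨x, hxE, hx⟩ := exists_degree_mul_le M ⟨_, hC.1.subset_ground hC.1.nonempty.some_mem⟩
  obtain ⟨hd', hC1', hC2', hle⟩ :=
    ncard_triangles_le_add_of_not_isColoop M hC1 hC2 (d := 6) hd hxE (hcol' x hxE)
  have hC3' : ∀ X ⊆ (M ＼ {x}).E, (M ＼ {x}).eRk X ≤ 4 → X.ncard ≤ 10 := by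
    intro X hX hr
    rw [_root_.Matroid.delete_ground] at hX
    rw [delete_singleton_eRk_eq hX] at hr
    exact hC3 X (hX.trans Set.sdiff_subset) hr
  have h10 := ncard_triangles_le_cq (M ＼ {x}) hC1' hC2' hC3' hd'
  rw [show cq 6 = 10 by decide] at h10
  have hxnl : M.IsNonloop x := by
    have h3 := hdeg3 x hxE
    have hTfin : (ThmN.trianglesThrough M x).Finite :=
      M.ground_finite.finite_subsets.subset (fun C hC => hC.1.subset_ground)
    obtain ⟨T, hT⟩ : (ThmN.trianglesThrough M x).Nonempty := by
      rw [← Set.ncard_pos hTfin]; omega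
    rw [← _root_.Matroid.indep_singleton]
    refine hT.1.ssubset_indep ?_
    refine (Set.singleton_subset_iff.2 hT.2.2).ssubset_of_ne ?_
    intro h
    have := congrArg Set.ncard h
    rw [Set.ncard_singleton, hT.2.1] at this
    omega
  have hx5 := hdeg5 x hxnl
  have hx3 := hdeg3 x hxE
  have hx3' : (ThmN.trianglesThrough M x).ncard = 3 := by
    rcases Nat.lt_or_ge (ThmN.trianglesThrough M x).ncard 4 with h | h
    · omega
    · -- `t(x) ∈ {4, 5}` contradicts `t(x)·m ≤ 3·s₃ ≤ 3·(t(x) + 10)` with `m ≥ 12`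
      exfalso
      rcases Nat.lt_or_ge (ThmN.trianglesThrough M x).ncard 5 with h4 | h5
      · have e : (ThmN.trianglesThrough M x).ncard = 4 := by omega
        rw [e] at hx hle
        omega
      · have e : (ThmN.trianglesThrough M x).ncard = 5 := by omega
        rw [e] at hx hle
        omega
  rw [hx3'] at hx hle
  have hs13 : (ThmN.triangles M).ncard = 13 := by omega
  have hm13 : M.E.ncard ≤ 13 := by omega
  have hs10 : (ThmN.triangles (M ＼ {x})).ncard = 10 := by omega
  -- `M' = M ∖ x`: its coloops `K`; `M'' = M' ∖ K` is coloop-free of nullity `6` with ten triangles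
  set M' := M ＼ {x} with hM'
  have hE' : M'.E = M.E \ {x} := rfl
  have hE'fin : M'.E.Finite := M'.ground_finite
  obtain ⟨K, hK⟩ : ∃ K : Set α, ∀ k, k ∈ K ↔ k ∈ M'.E ∧ M'.IsColoop k :=
    ⟨{k ∈ M'.E | M'.IsColoop k}, fun k => Iff.rfl⟩
  have hKE' : K ⊆ M'.E := fun k hk => ((hK k).1 hk).1
  have hKfin : K.Finite := hE'fin.subset hKE'
  have hKcol : ∀ k ∈ hKfin.toFinset, M'.IsColoop k :=
    fun k hk => ((hK k).1 ((Set.Finite.mem_toFinset hKfin).1 hk)).2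
  have hKcoe : ((hKfin.toFinset : Finset α) : Set α) = K := Set.Finite.coe_toFinset hKfin
  obtain ⟨hd'', htri''⟩ := delete_coloops_encard_triangles M' hKfin.toFinset hKcol (d := 6) hd'
  rw [hKcoe] at hd'' htri''
  set M'' := M' ＼ K with hM''
  have hE'' : M''.E = M'.E \ K := rfl
  have hs10'' : (ThmN.triangles M'').ncard = 10 := by rw [htri'']; exact hs10
  have hC1'' : ∀ L ⊆ M''.E, M''.eRk L = 2 → L.ncard ≤ 3 := by
    intro L hL hr
    rw [hE''] at hL
    rw [hM'', delete_eRk_eq_of_sdiff M' K hL] at hr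
    exact hC1' L (hL.trans Set.sdiff_subset) hr
  have hC2'' : ∀ P ⊆ M''.E, M''.eRk P ≤ 3 → P.ncard ≤ 6 := by
    intro P hP hr
    rw [hE''] at hP
    rw [hM'', delete_eRk_eq_of_sdiff M' K hP] at hr
    exact hC2' P (hP.trans Set.sdiff_subset) hr
  have hC3'' : ∀ X ⊆ M''.E, M''.eRk X ≤ 4 → X.ncard ≤ 10 := by
    intro X hX hr
    rw [hE''] at hX
    rw [hM'', delete_eRk_eq_of_sdiff M' K hX] at hr
    exact hC3' X (hX.trans Set.sdiff_subset) hr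
  -- `M''` is coloop-free
  have hfree'' : ∀ y ∈ M''.E, ¬ M''.IsColoop y := by
    intro y hy hcy
    have hyE' : y ∈ M'.E := hy.1
    have hyK : y ∉ K := hy.2
    apply hyK
    refine (hK y).2 ⟨hyE', ?_⟩
    rw [hM'', _root_.Matroid.delete_isColoop_iff] at hcy
    obtain ⟨hcy1, -, -⟩ := hcy
    rw [_root_.Matroid.isColoop_iff_notMem_closure_compl hyE']
    have hsplit : M'.E \ {y} = ((M'.E \ K) \ {y}) ∪ K := by
      ext z
      simp only [Set.mem_sdiff, Set.mem_singleton_iff, Set.mem_union]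
      constructor
      · rintro ⟨hzE, hzy⟩
        by_cases hzK : z ∈ K
        · exact Or.inr hzK
        · exact Or.inl ⟨⟨hzE, hzK⟩, hzy⟩
      · rintro (⟨⟨hzE, -⟩, hzy⟩ | hzK)
        · exact ⟨hzE, hzy⟩
        · exact ⟨hKE' hzK, fun h => hyK (h ▸ hzK)⟩
    rw [hsplit, _root_.Matroid.closure_union_eq_of_subset_coloops _ (fun k hk => ((hK k).1 hk).2)]
    rintro (h | h)
    · exact hcy1 h
    · exact hyK h
  -- `|E' ∖ K| ≤ 10`: every point of `M''` lies on `≥ 3` of its ten triangles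
  have hdeg'' : ∀ y ∈ M''.E, 3 ≤ (ThmN.trianglesThrough M'' y).ncard := by
    intro y hy
    obtain ⟨hd3, hC1y, hC2y, hley⟩ :=
      ncard_triangles_le_add_of_not_isColoop M'' hC1'' hC2'' (d := 5) hd'' hy (hfree'' y hy)
    have h7 := ncard_triangles_le_seven_of_nullity_five (M'' ＼ {y}) hC1y hC2y hd3
    omega
  have hN10 : (M'.E \ K).ncard ≤ 10 := by
    have := mul_ncard_ground_le_three_mul_ncard_triangles M'' 3 hdeg''
    rw [hE'', hs10''] at this
    omega
  -- `|E' ∖ K| ≥ 10`: the rank facts on `M''`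
  obtain ⟨C'', hC''⟩ : (ThmN.triangles M'').Nonempty := by
    rw [← Set.ncard_pos (M''.ground_finite.finite_subsets.subset (fun C hC => hC.1.subset_ground))]
    omega
  obtain ⟨r'', hr'', hnr'', hr2''⟩ := two_add_le_eRank_of_triangle M'' hd'' hC''
  have hE2'' : r'' ≠ 2 ∨ M''.E.ncard ≤ 3 := by
    by_cases h : r'' = 2
    · refine Or.inr (hC1'' M''.E (subset_refl _) ?_)
      rw [← _root_.Matroid.eRank_def, hr'', h]; norm_num
    · exact Or.inl h
  have hE3'' : r'' ≠ 3 ∨ M''.E.ncard ≤ 6 := by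
    by_cases h : r'' = 3
    · refine Or.inr (hC2'' M''.E (subset_refl _) ?_)
      rw [← _root_.Matroid.eRank_def, hr'', h]; norm_num
    · exact Or.inl h
  have hE4'' : r'' ≠ 4 ∨ M''.E.ncard ≤ 10 := by
    by_cases h : r'' = 4
    · refine Or.inr (hC3'' M''.E (subset_refl _) ?_)
      rw [← _root_.Matroid.eRank_def, hr'', h]; norm_num
    · exact Or.inl h
  rw [hE''] at hnr'' hE2'' hE3'' hE4''
  have hN10' : 10 ≤ (M'.E \ K).ncard := by omega
  -- hence `|K| ≤ 2`
  have hE'card : M'.E.ncard + 1 = M.E.ncard := by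
    rw [hE']; exact Set.ncard_sdiff_singleton_add_one hxE M.ground_finite
  have hNKcard : (M'.E \ K).ncard + K.ncard = M'.E.ncard :=
    Set.ncard_sdiff_add_ncard_of_subset hKE' hE'fin
  have hK2 : K.ncard ≤ 2 := by omega
  have hK1 : 1 ≤ K.ncard := by omega
  -- every triangle through `x` meets `K`
  have hmeet : ∀ T ∈ ThmN.trianglesThrough M x, (T ∩ K).Nonempty := by
    intro T hT
    by_contra hemp
    rw [Set.not_nonempty_iff_eq_empty] at hemp
    have hTN : T \ {x} ⊆ M'.E \ K := by
      intro z hz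
      have hzE : z ∈ M.E := hT.1.subset_ground hz.1
      have hzK : z ∉ K := fun h => by
        have : z ∈ T ∩ K := ⟨hz.1, h⟩
        rw [hemp] at this
        exact this
      exact ⟨⟨hzE, hz.2⟩, hzK⟩
    have hxcl : x ∈ M.closure (M'.E \ K) :=
      M.closure_subset_closure hTN (hT.1.mem_closure_sdiff_singleton_of_mem hT.2.2)
    obtain ⟨k, hk⟩ : K.Nonempty := by
      rw [← Set.ncard_pos hKfin]; omega
    have hkc : M'.IsColoop k := ((hK k).1 hk).2
    rw [hM', _root_.Matroid.delete_isColoop_iff] at hkc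
    obtain ⟨hkcl, hkE, hkx⟩ := hkc
    apply hcol' k hkE
    rw [_root_.Matroid.isColoop_iff_notMem_closure_compl hkE]
    have hkx' : k ≠ x := fun h => hkx (by rw [Set.mem_singleton_iff]; exact h)
    have hsplit : M.E \ {k} = insert x ((M.E \ {x}) \ {k}) := by
      ext z
      simp only [Set.mem_sdiff, Set.mem_singleton_iff, Set.mem_insert_iff]
      constructor
      · rintro ⟨hzE, hzk⟩
        by_cases hzx : z = x
        · exact Or.inl hzx
        · exact Or.inr ⟨⟨hzE, hzx⟩, hzk⟩
      · rintro (hzx | ⟨⟨hzE, -⟩, hzk⟩)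
        · exact ⟨hzx ▸ hxE, fun h => hkx' (by rw [← h, hzx])⟩
        · exact ⟨hzE, hzk⟩
    have hNsub : M'.E \ K ⊆ (M.E \ {x}) \ {k} := by
      intro z hz
      refine ⟨hz.1, ?_⟩
      intro hzk
      rw [Set.mem_singleton_iff] at hzk
      exact hz.2 (hzk ▸ hk)
    have hxcl' : x ∈ M.closure ((M.E \ {x}) \ {k}) := M.closure_subset_closure hNsub hxcl
    rw [hsplit, _root_.Matroid.closure_insert_eq_of_mem_closure hxcl']
    exact hkcl
  -- distinct triangles through `x` carry distinct points of `K`: `t(x) ≤ |K|`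
  obtain ⟨f, hf⟩ : ∃ f : Set α → α, ∀ T, (T ∩ K).Nonempty → f T ∈ T ∩ K :=
    ⟨fun T => if h : (T ∩ K).Nonempty then h.some else x,
      fun T h => by simp only [dif_pos h]; exact h.some_mem⟩
  have hinj : (ThmN.trianglesThrough M x).ncard ≤ K.ncard := by
    refine Set.ncard_le_ncard_of_injOn f (fun T hT => (hf T (hmeet T hT)).2) ?_ hKfin
    intro T₁ hT₁ T₂ hT₂ hfe
    by_contra hne
    have hk₁ := hf T₁ (hmeet T₁ hT₁)
    have hk₂ := hf T₂ (hmeet T₂ hT₂)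
    rw [hfe] at hk₁
    have hinter := ThmN.inter_eq_singleton_of_mem_trianglesThrough M hC1 hT₁ hT₂ hne
    have hmem : f T₂ ∈ T₁ ∩ T₂ := ⟨hk₁.1, hk₂.1⟩
    rw [hinter, Set.mem_singleton_iff] at hmem
    have hkE' : f T₂ ∈ M'.E := hKE' hk₂.2
    exact hkE'.2 (by rw [Set.mem_singleton_iff]; exact hmem)
  omega

end S1

end PercRepro
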